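/-
Origin: expansion seat `planner-pub-hodgecm-pv09-g3-0`, handover #6 2026-08-18T05:45:02Z (`HOME/pub-hodgecm-pv09-g3/lean/Pv09g3/UnramifiedNonsplit.lean`, md5 47faff7a, 153 lines);
landed by the gen-6 packager in gate run 23 as `HodgeCM/PerL34/UnramifiedNonsplit.lean` (import ^import Pv[0-9]+g[0-9]+\.→import HodgeCM.PerL34. ×1).
-/
/-
Copyright: HodgeCM publication cell (pub-hodgecm), DAG node N31 / N31g, seam (I) (prover pv09, gen 3).
Released under the package licence.

# N31g first value, KERNEL for the canonical local integrands: `I_v(φ⁰_v) = 1` at a non-split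
# unramified place, FROM "φ⁰ is K_T-fixed" (the clause reviewer E5 asked to be made explicit)

Source under adjudication (NOT cited as a fact; this file PROVES a typed piece of it):
PerL v5 = `inputs/2001/summits__hodge-w-picard-modular-quadrilinear-period-galois-
closure__free__y1__paper__paper.tex`, Lemma 4.2(b), proof, tex ll. 628–629, verbatim:

  628: ... Enlarging $S$, for $v\notin S$ also $\phi_v=\phi^0_v$ and all splitting data are
  629: unramified, and then $I_v(\phi^0_v)=1$, resp.\ (at split $v$, ...

(reviewer-v5 E5 / GAPS adv4g7-X5: "I_v(φ⁰_v) = 1 silently uses that φ⁰_v is U(W_i)(𝒪_v)-fixed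
and that χ′_v is unramified; make the invariance explicit".)

## What this file does

pv10's `UnramifiedFactors.nonsplit_integral_eq_one` (LANDED run 19) proves `∫ coeff · χ = 1` from
the HYPOTHESES `coeff ≡ 1`, `χ ≡ 1` (on a conull compact subgroup of volume one).  For the
CANONICAL local integrand `localIntegrand B D ω φ χ′ i` of this seat (`PureTensorPieces`) both
hypotheses are now THEOREMS of the global data:
* `localCoeff_eq_one_of_mem` : `hK` (φ fixed by the box subgroup `K_T`) + `‖φ‖ = 1` ⇒
  `⟪φ, ω(ι_i k)φ⟫ = 1` for `i ∉ T`, `k ∈ B i` (pv10 `RestrictedProduct.mulSingle_mem_boxSubgroup`);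
* `localChar_eq_one_of_mem` : `K_{T′} ≤ ker χ′` (pv10 no-small-subgroups: such `T′` EXISTS for a
  continuous unitary `χ′`, `PureTensorChar.exists_boxSubgroup_le_ker`) ⇒ `χ′(ι_i k) = 1` for
  `i ∉ T′`, `k ∈ B i`;
* `localIntegrand_f_eq_one` : hence the local integrand is `≡ 1` on `B i` for `i ∉ T ∪ T′`;
* **`localIntegrand_I_eq_one`** : if moreover `B i` is ALL of `G i` (non-split `v`: `U(W_i)(L_{0,v})`
  `= U(1)(L_v/L_{0,v})` is compact and equals its integral points `K_v` for `v` inert / unramified)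
  and `ν_i(G_i) = 1` (the normalisation `vol K_v = 1` of pv09-g2 `ofHaar`), then
  `(localIntegrand B D ω φ χ′ i).Ic = 1` and `(…).I = 1` — pv13's field `LocalFactorPieces.nonsplit_val`
  / `EulerProduct.TailHyps.nonsplit_val` for the canonical local factors (the input `hns :
  ν_i(G_i) ≤ 1` of `EulerBound.hB_of_places` at the same places is then `hν.le`);
* `localIntegrand_Ic_eq_one_ae` / `localIntegrand_I_eq_one_ae` : the variant with `B i` only
  CONULL (`ν_i (B i)ᶜ = 0`), the shape of pv10's `nonsplit_integral_eq_one_ae`.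

RESIDUAL (honest): `hK` (D4/D5, posited), continuity of `χ′` (gives `T′`), and the two SETUP facts at a
non-split unramified place — `(B i : Set (G i)) = univ` (or conull) and `ν_i univ = 1`.  Nothing is
cited; no hypothesis names PerL, QW8 or a 2001-programme claim.  Imports: this seat's
`PureTensorPieces` + LANDED `HodgeCM.PerL34.UnramifiedFactors` (pv10); axioms = the standard trio.
Unit `pub-hodgecm-pv09-g3` (DAG-node prover #09, generation 3), 2026-08-18.
-/
import Summits.HodgeConjecture.HodgeCM.PerL34.PureTensorPieces
import Summits.HodgeConjecture.HodgeCM.PerL34.UnramifiedFactors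

/-! PORT of `HodgeCM/PerL34/UnramifiedNonsplit.lean` (HodgeCMPerL run 82) — verbatim mechanical port; provenance in the PORT header line. -/

set_option autoImplicit false

noncomputable section

open MeasureTheory Set Filter Function Topology Complex ComplexConjugate

open scoped RestrictedProduct InnerProductSpace

namespace HodgeCM.PerL34.PureTensor

open HodgeCM.PerL34.AdelicFactorisation HodgeCM.PerL34.RestrictedMeasure
  HodgeCM.PerL34.NoSmallSubgroups HodgeCM.PerL34.EulerFactorisation

section values

variable {ι : Type} {G : ι → Type} [∀ i, Group (G i)] [DecidableEq ι]
  {Sub : ι → Type*} [∀ i, SetLike (Sub i) (G i)] [∀ i, SubgroupClass (Sub i) (G i)]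
  (B : ∀ i, Sub i)
  {Sp : Type} [NormedAddCommGroup Sp] [InnerProductSpace ℂ Sp]
  (ω : (Πʳ j, [G j, B j]) →* (Sp ≃ₗᵢ[ℂ] Sp)) (φ : Sp)

/-- **"φ⁰_v is K_v-fixed" ⇒ the local coefficient is `1` on `K_v`** (`i ∉ T`, `‖φ‖ = 1`). -/
theorem localCoeff_eq_one_of_mem (hφ : ‖φ‖ = 1) {T : Finset ι}
    (hK : ∀ k ∈ RestrictedProduct.boxSubgroup B T, ω k φ = φ) {i : ι} (hi : i ∉ T) {k : G i}
    (hk : k ∈ B i) : localCoeff B ω φ i k = 1 := by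
  unfold localCoeff
  rw [hK _ (RestrictedProduct.mulSingle_mem_boxSubgroup T hi hk), inner_self_eq_norm_sq_to_K, hφ]
  simp

/-- **"χ′_v is unramified" ⇒ `χ′_v = 1` on `K_v`** (`K_{T′} ≤ ker χ′`, `i ∉ T′`). -/
theorem localChar_eq_one_of_mem (χ : (Πʳ j, [G j, B j]) →* Circle) {T' : Finset ι}
    (hχ : RestrictedProduct.boxSubgroup B T' ≤ χ.ker) {i : ι} (hi : i ∉ T') {k : G i}
    (hk : k ∈ B i) : ((χ (RestrictedProduct.mulSingle B i k) : Circle) : ℂ) = 1 := by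
  have h : χ (RestrictedProduct.mulSingle B i k) = 1 :=
    hχ (RestrictedProduct.mulSingle_mem_boxSubgroup T' hi hk)
  rw [h, Circle.coe_one]

variable [∀ i, MeasurableSpace (G i)] [∀ i, MeasurableInv (G i)]
  (D : RestrictedProductMeasureDatum ι G (Πʳ j, [G j, B j])) [∀ i, (D.ν i).IsInvInvariant]
  (χ : (Πʳ j, [G j, B j]) →* Circle)

/-- Hence the canonical local integrand is `≡ 1` on `B i` for `i ∉ T ∪ T′`. -/
theorem localIntegrand_f_eq_one (hφ : ‖φ‖ = 1) {T T' : Finset ι}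
    (hK : ∀ k ∈ RestrictedProduct.boxSubgroup B T, ω k φ = φ)
    (hχ : RestrictedProduct.boxSubgroup B T' ≤ χ.ker) {i : ι} (hiT : i ∉ T) (hiT' : i ∉ T')
    {k : G i} (hk : k ∈ B i) : (localIntegrand B D ω φ χ i).f k = 1 := by
  rw [localIntegrand_f, localCoeff_eq_one_of_mem B ω φ hφ hK hiT hk,
    localChar_eq_one_of_mem B χ hχ hiT' hk, one_mul]

/-- **l. 629 "then `I_v(φ⁰_v) = 1`", KERNEL for the canonical local factor**: at a place
`i ∉ T ∪ T′` where `B i` is all of `G i` (non-split unramified: the local group is compact and equals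
`K_v`) and `ν_i(G_i) = 1`, the complex local factor is `1` … -/
theorem localIntegrand_Ic_eq_one (hφ : ‖φ‖ = 1) {T T' : Finset ι}
    (hK : ∀ k ∈ RestrictedProduct.boxSubgroup B T, ω k φ = φ)
    (hχ : RestrictedProduct.boxSubgroup B T' ≤ χ.ker) {i : ι} (hiT : i ∉ T) (hiT' : i ∉ T')
    (hBi : (B i : Set (G i)) = Set.univ) (hν : D.ν i Set.univ = 1) :
    (localIntegrand B D ω φ χ i).Ic = 1 := by
  have hmem : ∀ k : G i, k ∈ B i := fun k => by
    have : k ∈ (B i : Set (G i)) := by rw [hBi]; exact Set.mem_univ k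
    exact this
  haveI : IsProbabilityMeasure (D.ν i) := ⟨hν⟩
  change ∫ k, (localIntegrand B D ω φ χ i).f k ∂D.ν i = 1
  refine (integral_congr_ae (Eventually.of_forall fun k =>
    localIntegrand_f_eq_one B ω φ D χ hφ hK hχ hiT hiT' (hmem k))).trans ?_
  rw [integral_const, probReal_univ, one_smul]

/-- … and so is the real local factor: pv13's `nonsplit_val` field for the canonical `I`. -/
theorem localIntegrand_I_eq_one (hφ : ‖φ‖ = 1) {T T' : Finset ι}
    (hK : ∀ k ∈ RestrictedProduct.boxSubgroup B T, ω k φ = φ)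
    (hχ : RestrictedProduct.boxSubgroup B T' ≤ χ.ker) {i : ι} (hiT : i ∉ T) (hiT' : i ∉ T')
    (hBi : (B i : Set (G i)) = Set.univ) (hν : D.ν i Set.univ = 1) :
    (localIntegrand B D ω φ χ i).I = 1 := by
  have h := localIntegrand_Ic_eq_one B ω φ D χ hφ hK hχ hiT hiT' hBi hν
  unfold LocalIntegrand.I
  rw [h, Complex.one_re]

/-- Variant with `B i` only CONULL (`ν_i (B i)ᶜ = 0`) and `ν_i (B i) = 1`, via pv10's
`nonsplit_integral_eq_one_ae`-type reasoning done directly. -/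
theorem localIntegrand_Ic_eq_one_ae (hφ : ‖φ‖ = 1) {T T' : Finset ι}
    (hK : ∀ k ∈ RestrictedProduct.boxSubgroup B T, ω k φ = φ)
    (hχ : RestrictedProduct.boxSubgroup B T' ≤ χ.ker) {i : ι} (hiT : i ∉ T) (hiT' : i ∉ T')
    (hBc : D.ν i (B i : Set (G i))ᶜ = 0) (hν : D.ν i Set.univ = 1) :
    (localIntegrand B D ω φ χ i).Ic = 1 := by
  haveI : IsProbabilityMeasure (D.ν i) := ⟨hν⟩
  have hB : (B i : Set (G i)) ∈ ae (D.ν i) := mem_ae_iff.mpr hBc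
  change ∫ k, (localIntegrand B D ω φ χ i).f k ∂D.ν i = 1
  refine (integral_congr_ae (g := fun _ => (1 : ℂ)) ?_).trans ?_
  · filter_upwards [hB] with k hk
    exact localIntegrand_f_eq_one B ω φ D χ hφ hK hχ hiT hiT' hk
  · rw [integral_const, probReal_univ, one_smul]

/-- … with the real local factor. -/
theorem localIntegrand_I_eq_one_ae (hφ : ‖φ‖ = 1) {T T' : Finset ι}
    (hK : ∀ k ∈ RestrictedProduct.boxSubgroup B T, ω k φ = φ)
    (hχ : RestrictedProduct.boxSubgroup B T' ≤ χ.ker) {i : ι} (hiT : i ∉ T) (hiT' : i ∉ T')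
    (hBc : D.ν i (B i : Set (G i))ᶜ = 0) (hν : D.ν i Set.univ = 1) :
    (localIntegrand B D ω φ χ i).I = 1 := by
  have h := localIntegrand_Ic_eq_one_ae B ω φ D χ hφ hK hχ hiT hiT' hBc hν
  unfold LocalIntegrand.I
  rw [h, Complex.one_re]

end values

end HodgeCM.PerL34.PureTensor

end
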